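import Summits.HubbardSuperconductivity.HubbardLadder.Bounds.AttractivePairBreakingFloor
import Summits.HubbardSuperconductivity.HubbardLadder.Bounds.StiffnessFromEnergyBracketsSharp
import HarnessLib

/-!
# Hubbard ladder — Bounds: DENSITY-proportional kinetic and stiffness ceilings of the attractive
# Hubbard class (bounds.tex Thm 9(ii)–(iv), typed AND proved; part 2 of 2)

HONEST FRAMING (cell pub-hubbard): ladder R1–R4 with certified numbers; no claim on H/H₀.
Bounds for a MODEL CLASS (the torus `hubbardTorus 2 L 1 U`, `t = 1`, `t' = 0`, `U < 0`); no
materials claim. Companion text: `pub-hubbard/paper/bounds.tex` §9; BOUNDS.md row T7.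
Part 1 = `AttractivePairBreakingFloor.lean` (the floor `E_L(U; 2m, 0) ≥ U m - 64 m/|U|`).

## What is proved (no `sorry`, no new axioms)

* `AttractiveKineticCeilingDensity` (PROVED): `L ≥ 3`, `U < 0`, `m ≤ L²`: every unit ground
  state of `hubbardTorus 2 L 1 U` in the sector `(2m, S^z = 0)` has
  `⟨-T⟩_ψ = 2(K_x + K_y)(ψ) ≤ 256 m/|U|` — the TIGHT chord of `StiffnessFromEnergyBracketsSharp`
  (`two_mul_kinWeight_le_of_energyBrackets_attractive_sharp`) at `U₁ = U/2` with `E(U) ≤ U m`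
  (no-hopping trial state) and the pair-breaking floor at `U/2`: the extensive `U m` terms
  cancel and NO volume term is left (`128 t²/|U|` per particle).
* `AttractiveStiffnessCeilingDensity` (PROVED): `L ≥ 3`, `U < 0`, filling `1 - δ = n`
  (`δ ≥ -1`): every flux stiffness of the `(N_L, S^z = 0)` sector (`N_L = 2⌊(1-δ)L²/2⌋`,
  `ρ_s θ² ≤ E_L(θ) - E_L(0)` for `|θ| ≤ θ₀`) obeys `ρ_s ≤ 32(1-δ)/|U| = 32 n t²/|U|`, uniformly
  in `L` (f-sum floor `ρ_s L² ≤ K_x`, the `D₄` rotation, `4 ρ_s L² ≤ ⟨-T⟩ ≤ 256 m/|U|`,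
  `m ≤ n L²/2`); `AttractiveStiffnessCeilingDensityTL` (the cell's thermodynamic-limit
  convention); `AttractiveStiffnessBECLimitDensity` (`U ≤ -32 n/ε ⇒ ρ_s ≤ ε`); the decimal
  instance `AttractiveStiffnessCeilingDensityU80` (`n = 1/10`, `U = -80 t`: `ρ_s ≤ 0.04 t`, where
  the volume ceilings give `0.1`–`0.125 t` and the band value is `n t = 0.1 t`).
NUMBERS (honest): `32 n/|U|` is below the tight volume ceiling `8/|U|` iff `n < 1/4` and below the
band value `n t` iff `|U| > 32 t` — informative in the dilute BEC corner only, where it is the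
first ceiling with the physical scaling `n t²/|U|` (expected `O(1)·n t²/|U|`; by the particle–hole
symmetry of the bipartite torus the same holds with `n ↦ 2 - n`, paper only). With the thermal
chord (bounds.tex Thm 9(v), paper proof) it gives the `NK₂`-conditional
`T_c ≤ 64 n t²/(|U|(8/π - 2 h(n/2))) ≤ 55.2 n t²/|U|` (Cor. 9.1; `→ 8π n t²/|U|` as `n → 0`),
below the density-blind `16 t²/(|U|(8/π - 2h(n/2)))` of Cor. 8.1♯ exactly for `n < 1/4`. Nearest
prior art: the second-order hard-core-boson picture of the attractive Hubbard model (Randeria's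
review in Griffin–Snoke–Stringari 1995, p. 320: boson hopping `2t²/|U|`, heuristic
`ρ_s ≈ n t²/|U|`, so the `32` is loose by `≈ 30`); HazraVermaRanderia2019 §III, App. G.
References (`lean/references.bib`): HazraVermaRanderia2019; ScalapinoWhiteZhang1993 §II (f-sum
floor); KomaTasaki1994 §1; LiebPRL1989; Nagaoka1966.
-/

noncomputable section

namespace Summit.HubbardSuperconductivity.HubbardLadder.Bounds

open Matrix Finset Real Filter Topology
open Literature.MathematicalPhysics.QuantumLattice
open Literature.MathematicalPhysics.QuantumFieldTheory
open Literature.Probability.LatticeModels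
open Literature.MathematicalPhysics.QuantumLattice.ThermodynamicLimit
open scoped ComplexOrder ComplexConjugate Topology

variable {L : ℕ} [NeZero L]

/-! ### Node 1 — the density-proportional kinetic ceiling `⟨-T⟩ ≤ 256 m/|U|` (Thm 9(ii)) -/

/-- The TIGHT attractive chord at `U₁ = U/2` with `E(U) ≤ U m` and the pair-breaking floor at
`U/2`: the extensive `U m` terms cancel and no volume term remains. -/
theorem two_mul_kinWeight_le_attractive_density (hL : 3 ≤ L) {U : ℝ} (hU : U < 0) {m : ℕ}
    (hm : m ≤ L ^ 2) {ψ : Fock (Orb (FermionTorus 2 L))}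
    (hgs : IsGroundStateInSector (hubbardTorus 2 L 1 U) (2 * m) 0 ψ) (h1 : star ψ ⬝ᵥ ψ = 1) :
    2 * (kinWeightDir 0 ψ + kinWeightDir 1 ψ) ≤ 256 * m / (-U) := by
  have hR := sectorEnergy_two_mul_le_mul (L := L) U hm
  have hL₁ := sectorEnergy_two_mul_ge_pairBreaking (L := L) (U := U / 2) (by linarith) hm
  have h := two_mul_kinWeight_le_of_energyBrackets_attractive_sharp hL (by linarith : U / 2 ≤ 0)
    (by linarith : U < U / 2) hgs h1 hR hL₁
  have hU0 : U ≠ 0 := hU.ne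
  have hV : -U ≠ 0 := neg_ne_zero.2 hU0
  have hV2 : -(U / 2) ≠ 0 := by intro h'; apply hU0; linarith
  have hd : U / 2 - U ≠ 0 := by intro h'; apply hU0; linarith
  have key : (U * (U / 2 * m - 64 * m / (-(U / 2))) - U / 2 * (U * m)) / (U / 2 - U) =
      256 * m / (-U) := by
    field_simp
    ring
  linarith

/-- **Thm 9(ii) (density-proportional attractive kinetic ceiling; PROVED below).** `L ≥ 3`,
`U < 0`, `m ≤ L²`: every unit ground state `ψ` of `hubbardTorus 2 L 1 U` in the sector
`(2m, S^z = 0)` has `⟨-T⟩_ψ = 2(K_x + K_y)(ψ) ≤ 256 m/|U|` — kinetic energy `≤ 128 t²/|U|` per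
PARTICLE. kind: support (PROVED). Why it might fail: it cannot; it beats the volume ceiling
`32 L²/|U|` iff `m < L²/8` and the band value `8 m` iff `|U| > 32`. Sources: Nagaoka1966 §II;
KomaTasaki1994 §1; HazraVermaRanderia2019 App. G; this cell. -/
@[conjecture] def AttractiveKineticCeilingDensity : Prop :=
  ∀ (L : ℕ) [NeZero L], 3 ≤ L → ∀ (U : ℝ) (m : ℕ), U < 0 → m ≤ L ^ 2 →
    ∀ ψ : Fock (Orb (FermionTorus 2 L)), IsGroundStateInSector (hubbardTorus 2 L 1 U) (2 * m) 0 ψ →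
      star ψ ⬝ᵥ ψ = 1 → 2 * (kinWeightDir 0 ψ + kinWeightDir 1 ψ) ≤ 256 * m / (-U)

/-- **Proof of `AttractiveKineticCeilingDensity`.** -/
theorem attractiveKineticCeilingDensity_holds : AttractiveKineticCeilingDensity := by
  intro L _ hL U m hU hm ψ hgs h1
  exact two_mul_kinWeight_le_attractive_density hL hU hm hgs h1

/-! ### Node 2 — the stiffness ceiling `ρ_s ≤ 32 n t²/|U|` (Thm 9(iii)) -/

/-- **Thm 9(iii) (density-proportional attractive stiffness ceiling, finite torus; PROVED
below).** `L ≥ 3`, `U < 0`, filling `1 - δ` (`δ ≥ -1`): every flux stiffness `ρ_s > 0` of the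
`(N_L, S^z = 0)` sector of `hubbardTorus 2 L 1 U` (`ρ_s θ² ≤ E_L(θ) - E_L(0)` for `|θ| ≤ θ₀`,
`E_L(θ) = fluxEnergy L U δ θ`, `N_L = 2⌊(1-δ)L²/2⌋`) satisfies `ρ_s ≤ 32(1 - δ)/|U|` (`t = 1`;
`1 - δ = n`, the density), uniformly in `L`. kind: support (PROVED). Why it might fail: it cannot;
it is informative only in the dilute BEC corner `n < 1/4`, `|U| > 32 t`. Sources:
ScalapinoWhiteZhang1993 §II; HazraVermaRanderia2019 §III, App. G; this cell. -/
@[conjecture] def AttractiveStiffnessCeilingDensity : Prop :=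
  ∀ (L : ℕ) [NeZero L], 3 ≤ L → ∀ (U δ ρs θ₀ : ℝ), -1 ≤ δ → U < 0 → 0 < ρs → 0 < θ₀ →
    (∀ θ : ℝ, |θ| ≤ θ₀ → ρs * θ ^ 2 ≤ fluxEnergy L U δ θ - fluxEnergy L U δ 0) →
      ρs ≤ 32 * (1 - δ) / (-U)

/-- **Proof of `AttractiveStiffnessCeilingDensity`**: f-sum floor on a unit ground state `ψ` and
on `Γ(r)ψ`, `K_y(Γ(r)ψ) = K_x(ψ)`, Thm 9(ii) for `Γ(r)ψ`: `4 ρ_s L² ≤ 256 m/|U|`, and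
`m = ⌊(1-δ)L²/2⌋ ≤ (1-δ)L²/2` (for `δ > 1`, `m = 0` contradicts `ρ_s > 0`). -/
theorem attractiveStiffnessCeilingDensity_holds : AttractiveStiffnessCeilingDensity := by
  intro L _ hL U δ ρs θ₀ hδ hU hρs hθ₀ hst
  have hm : ⌊(1 - δ) * (L : ℝ) ^ 2 / 2⌋₊ ≤ L ^ 2 := NoGo.floor_pairNumber_le δ hδ L
  obtain ⟨ψ, h1, hgs⟩ := NoGo.exists_unit_groundStateInSector_hubbardTorus L 1 U hm
  set φ : Fock (Orb (FermionTorus 2 L)) :=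
    fockMapOp (d4Orb (DihedralGroup.r 1 : DihedralGroup 4)) *ᵥ ψ with hφ_def
  have hφgs : IsGroundStateInSector (hubbardTorus 2 L 1 U) (2 * ⌊(1 - δ) * (L : ℝ) ^ 2 / 2⌋₊) 0 φ :=
    hgs.fockMapOp_d4Orb_mulVec _
  have hφ1 : star φ ⬝ᵥ φ = 1 := by
    rw [hφ_def, star_fockMapOp_mulVec_dotProduct_self _ (d4Orb_bijective _).injective, h1]
  have hKy : kinWeightDir 1 φ = kinWeightDir 0 ψ := kinWeightDir_one_rot ψ
  have hfψ : ρs * (L : ℝ) ^ 2 ≤ kinWeightDir 0 ψ :=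
    (stiffness_mul_sq_le_sum_re_hop_of_isGroundStateInSector hL U δ hρs hθ₀ hst hgs h1).trans_eq
      (kinWeightX_eq_kinWeightDir ψ)
  have hfφ : ρs * (L : ℝ) ^ 2 ≤ kinWeightDir 0 φ :=
    (stiffness_mul_sq_le_sum_re_hop_of_isGroundStateInSector hL U δ hρs hθ₀ hst hφgs hφ1).trans_eq
      (kinWeightX_eq_kinWeightDir φ)
  have hb := two_mul_kinWeight_le_attractive_density hL hU hm hφgs hφ1
  rw [hKy] at hb
  have hL2 : (0 : ℝ) < (L : ℝ) ^ 2 := by have := NeZero.pos L; positivity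
  have hV : 0 < -U := neg_pos.2 hU
  have hρL : 0 < ρs * (L : ℝ) ^ 2 := mul_pos hρs hL2
  by_cases hδ1 : δ ≤ 1
  · have hx : 0 ≤ (1 - δ) * (L : ℝ) ^ 2 / 2 := by
      have : 0 ≤ 1 - δ := by linarith
      positivity
    have hmU : 256 * ((⌊(1 - δ) * (L : ℝ) ^ 2 / 2⌋₊ : ℕ) : ℝ) / (-U) ≤
        256 * ((1 - δ) * (L : ℝ) ^ 2 / 2) / (-U) :=
      div_le_div_of_nonneg_right (by linarith [Nat.floor_le hx]) hV.le
    have key : ρs * (L : ℝ) ^ 2 ≤ 32 * (1 - δ) / (-U) * (L : ℝ) ^ 2 := by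
      have : 256 * ((1 - δ) * (L : ℝ) ^ 2 / 2) / (-U) =
          4 * (32 * (1 - δ) / (-U) * (L : ℝ) ^ 2) := by ring
      linarith
    exact le_of_mul_le_mul_right key hL2
  · exfalso
    have hx : (1 - δ) * (L : ℝ) ^ 2 / 2 ≤ 0 := by
      have : (1 - δ) * (L : ℝ) ^ 2 ≤ 0 :=
        mul_nonpos_of_nonpos_of_nonneg (by linarith [not_le.1 hδ1]) hL2.le
      linarith
    rw [Nat.floor_of_nonpos hx] at hb
    simp only [Nat.cast_zero, mul_zero, zero_div] at hb
    linarith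

/-- **BEC limit at fixed density (PROVED below)**: `L ≥ 3`, `δ ≥ -1`, `ε > 0`, `U < 0`,
`U ≤ -32(1-δ)/ε`: every flux stiffness `ρ_s > 0` of the `(N_L, S^z = 0)` sector of
`hubbardTorus 2 L 1 U` satisfies `ρ_s ≤ ε`. kind: support (PROVED). Why it might fail: it
cannot. Sources: as Thm 9(iii). -/
@[conjecture] def AttractiveStiffnessBECLimitDensity : Prop :=
  ∀ (L : ℕ) [NeZero L], 3 ≤ L → ∀ (U δ ρs θ₀ ε : ℝ), -1 ≤ δ → 0 < ε → U < 0 →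
    U ≤ -(32 * (1 - δ) / ε) → 0 < ρs → 0 < θ₀ →
    (∀ θ : ℝ, |θ| ≤ θ₀ → ρs * θ ^ 2 ≤ fluxEnergy L U δ θ - fluxEnergy L U δ 0) → ρs ≤ ε

/-- **Proof of `AttractiveStiffnessBECLimitDensity`**: `32(1-δ)/|U| ≤ ε`. -/
theorem attractiveStiffnessBECLimitDensity_holds : AttractiveStiffnessBECLimitDensity := by
  intro L _ hL U δ ρs θ₀ ε hδ hε hU hUε hρs hθ₀ hst
  have h := attractiveStiffnessCeilingDensity_holds L hL U δ ρs θ₀ hδ hU hρs hθ₀ hst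
  have hV : 0 < -U := neg_pos.2 hU
  have hle : 32 * (1 - δ) / (-U) ≤ ε := by
    rw [div_le_iff₀ hV]
    have h'' := (div_le_iff₀ hε).1 (by linarith : 32 * (1 - δ) / ε ≤ -U)
    linarith
  exact h.trans hle

/-! ### Node 3 — thermodynamic limit and a decimal instance (Thm 9(iv)) -/

/-- **Thm 9(iv) (density-proportional attractive stiffness ceiling, thermodynamic limit; PROVED
below).** If `ρ_s > 0` is a flux stiffness of the `(N_L, S^z = 0)` sectors of
`hubbardTorus 2 L 1 U` (`U < 0`, `δ ≥ -1`) for all large even `L` (same `ρ_s, θ₀`), then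
`ρ_s ≤ 32(1-δ)/|U|`. kind: support (PROVED; the finite-volume ceiling is uniform in `L`).
Why it might fail: it cannot. Sources: as Thm 9(iii). -/
@[conjecture] def AttractiveStiffnessCeilingDensityTL : Prop :=
  ∀ (U δ ρs θ₀ : ℝ), -1 ≤ δ → U < 0 → 0 < ρs → 0 < θ₀ →
    (∃ L₀ : ℕ, ∀ (L : ℕ) [NeZero L], L₀ ≤ L → Even L →
      ∀ θ : ℝ, |θ| ≤ θ₀ → ρs * θ ^ 2 ≤ fluxEnergy L U δ θ - fluxEnergy L U δ 0) →
      ρs ≤ 32 * (1 - δ) / (-U)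

/-- **Proof of `AttractiveStiffnessCeilingDensityTL`**: the finite-volume ceiling on the even
torus `L = 2(L₀ + 2) ≥ max(L₀, 4)`. -/
theorem attractiveStiffnessCeilingDensityTL_holds : AttractiveStiffnessCeilingDensityTL := by
  intro U δ ρs θ₀ hδ hU hρs hθ₀ hst
  obtain ⟨L₀, hst⟩ := hst
  haveI : NeZero (2 * (L₀ + 2)) := ⟨by omega⟩
  exact attractiveStiffnessCeilingDensity_holds (2 * (L₀ + 2)) (by omega) U δ ρs θ₀ hδ hU hρs hθ₀
    (hst (2 * (L₀ + 2)) (by omega) (even_two_mul _))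

/-- **`n = 1/10`, `U = -80 t`: `ρ_s ≤ 0.04 t`** for every flux stiffness of the `(N_L, S^z = 0)`
sector (`δ = 9/10`) of every torus `L ≥ 3` (the volume ceilings give `0.1`–`0.125 t`, the band
value `n t = 0.1 t`). kind: support (PROVED). -/
@[conjecture] def AttractiveStiffnessCeilingDensityU80 : Prop :=
  ∀ (L : ℕ) [NeZero L], 3 ≤ L → ∀ (ρs θ₀ : ℝ), 0 < ρs → 0 < θ₀ →
    (∀ θ : ℝ, |θ| ≤ θ₀ →
      ρs * θ ^ 2 ≤ fluxEnergy L (-80) (9 / 10) θ - fluxEnergy L (-80) (9 / 10) 0) → ρs ≤ 0.04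

/-- **Proof of `AttractiveStiffnessCeilingDensityU80`.** -/
theorem attractiveStiffnessCeilingDensityU80_holds : AttractiveStiffnessCeilingDensityU80 := by
  intro L _ hL ρs θ₀ hρs hθ₀ hst
  have h := attractiveStiffnessCeilingDensity_holds L hL (-80) (9 / 10) ρs θ₀ (by norm_num)
    (by norm_num) hρs hθ₀ hst
  norm_num at h
  linarith

end Summit.HubbardSuperconductivity.HubbardLadder.Bounds

end
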